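import Literature.AnabelianGeometry.AbsoluteAnabelian.GaloisCyclotomeTower
import Literature.AnabelianGeometry.AbsoluteAnabelian.GaloisCyclotomeH2Levels
import Literature.AnabelianGeometry.AbsoluteAnabelian.FactorialChainZHat
import Literature.AnabelianGeometry.AbsoluteAnabelian.GaloisCyclotomeMLFHolds
import Literature.NumberTheory.GaloisRepresentations.ContinuousCohomologyTowerLimitInjective
import Literature.NumberTheory.GaloisRepresentations.LocalGlobalCohomologyFiniteProofs
import HarnessLib

/-!
# [AbsTopIII] Cor. 1.10 (i)(a) — `H²(G_k, μ_Ẑ(G_k)) ≅ Ẑ` HOLDS (discharge of `AbsTopIII.Cor_1_10_i_a`)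

S. Mochizuki, *Topics in Absolute Anabelian Geometry III*, Cor. 1.10 (i)(a) p. 42 (lit key
`paper:url-5493eb38cbb7`): "one constructs the natural isomorphism `H²(G_k, μ_Ẑ(G_k)) ⥲ Ẑ`
'group-theoretically' from `G_k`".  The typed fact (abc-iut-L4-t1, `CyclotomicSynchronization.lean`):
for every MLF `k`, `Nonempty (galCyclotomeH2 (Gal(k̄/k)) ≃+ ZHatCoeff)` — the REAL continuous cohomology
`H²` (Mathlib `continuousCohomology`) of the GROUP-THEORETIC cyclotome `μ_Ẑ(G_k) = Hom(ℚ/ℤ, lim_H (H^ab)_tors)`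
with its profinite topology and conjugation action.  PROVED here (`AbsTopIII.Cor_1_10_i_a_holds`),
unconditionally, from the tree's local class field theory:

1. `μ_{ℚ/ℤ}(G_k) ≅ μ(k̄)` `G_k`-equivariantly (`mlfGaloisCyclotomeIsRootsOfUnity_holds`, [AbsAnab]
   Prop. 1.2.1 (vi), abc-iut-L6-t11/L4-t1 lineages) ⟹ `μ_Ẑ(G_k)` is the inverse limit of the finite
   discrete modules `μ_{(i+1)!}(k̄)` as a topological representation (`galCyclotomeTower`);
2. `H²_cts(G, lim_i X_i) ≅ lim_i H²(G, X_i)` for towers of discrete modules with finite `H¹`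
   (`DiscreteTowerPresentation.limitClassesEquiv`, Neukirch–Schmidt–Wingberg (2.7.5)/(2.7.6)); `H¹(G_k, μ_n)`
   is finite (`finite_galoisCohomology_one_of_isNonarchimedeanLocalField`);
3. the residue maps `inv_n : H²(G_k, μ_n) ⥲ ℤ/n` (`Prop121vii.invLevel`, the unique `IsInvariantMap`;
   [AbsAnab] Prop. 1.2.1 (vii), Serre XIII §3) commute with the power maps (`invLevel_muPowHom`), giving
   `lim_i H²(G_k, μ_{(i+1)!}) ≅ lim_i ℤ/(i+1)!` (`limitClassesEquivZModChain`);
4. `lim_i ℤ/(i+1)! ≅ Ẑ = ZHatCoeff` (`nonempty_zmodChain_addEquiv_zhat`, free procyclic).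

HONEST FRAMING: classical, undisputed local class field theory and profinite bookkeeping (abc-iut cell,
layer L4, FACT-LIST row F-1387 `Cor_1_10_i_a`); nothing here bears on [IUTchIII] Cor. 3.12; no side taken.

## References
* [MochizukiAbsTopIII2015] S. Mochizuki, *Topics in Absolute Anabelian Geometry III*, Cor. 1.10 (i) p. 42.
* [NeukirchSchmidtWingberg2008] J. Neukirch, A. Schmidt, K. Wingberg, *Cohomology of Number Fields*,
  (2.7.6), (7.2.6).
-/

noncomputable section

open CategoryTheory Function

universe u

namespace Literature.AnabelianGeometry.AbsoluteAnabelian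

open Field
open Literature.NumberTheory.GaloisRepresentations
open Literature.NumberTheory.GaloisRepresentations.DiscreteGaloisModule

/-! ### The MLF case: `H²(G_K, μ_Ẑ(G_K)) ≅ lim_i H²(G_K, μ_{(i+1)!}) ≅ lim_i ℤ/(i+1)! ≅ Ẑ` -/

section MLF

variable (K : Type u) [Field K] [ValuativeRel K] [TopologicalSpace K] [IsNonarchimedeanLocalField K]
  [CharZero K]
variable (φ : muQZ (absoluteGaloisGroup K) ≃+ Additive (CommGroup.torsion (AlgebraicClosure K)ˣ))
  (hφ : ∀ (σ : absoluteGaloisGroup K) (x : muQZ (absoluteGaloisGroup K)),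
    (((Additive.toMul (φ (σ • x)) : CommGroup.torsion (AlgebraicClosure K)ˣ) :
        (AlgebraicClosure K)ˣ) : AlgebraicClosure K) =
      σ • (((Additive.toMul (φ x) : CommGroup.torsion (AlgebraicClosure K)ˣ) :
        (AlgebraicClosure K)ˣ) : AlgebraicClosure K))

/-- `H¹(G_K, μ_{(i+1)!}(K̄))` is finite at every level of the tower (finite coefficients, `p`-adic field).
[cite: MochizukiAbsTopIII2015, Cor 1.10 (i) p.42] -/
theorem finite_H1_galCyclotomeTower (i : ℕ) :
    Finite (continuousCohomology 1 ((galCyclotomeTower φ hφ).obj i)) :=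
  finite_galoisCohomology_one_of_isNonarchimedeanLocalField (mu K ((cycLevel i : ℕ+) : ℕ))

/-- **The levelwise residue maps on the inverse system**: `lim_i H²(G_K, μ_{(i+1)!}) → lim_i ℤ/(i+1)!`,
`(c_i)_i ↦ (inv_{(i+1)!} c_i)_i` — well defined because the `inv_n` commute with the power maps
(`invLevel_muPowHom_hom`). [cite: MochizukiAbsTopIII2015, Cor 1.10 (i) p.42] -/
def limitClassesToZModChain : (galCyclotomeTower φ hφ).limitClasses →+ zmodChain where
  toFun c := ⟨fun i => Prop121vii.invLevel K ((cycLevel i : ℕ+) : ℕ)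
      ((c : ∀ i, continuousCohomology 2 ((galCyclotomeTower φ hφ).obj i)) i), fun i =>
    (invLevel_muPowHom_hom K (N := ((cycLevel (i + 1) : ℕ+) : ℕ)) (n := ((cycLevel i : ℕ+) : ℕ))
        (d := i + 2) (by rw [cycLevel_succ]; rfl)
        ((c : ∀ i, continuousCohomology 2 ((galCyclotomeTower φ hφ).obj i)) (i + 1))).symm.trans
      (congrArg (Prop121vii.invLevel K ((cycLevel i : ℕ+) : ℕ)) (c.2 i))⟩
  map_zero' := Subtype.ext (funext fun i => by
    change Prop121vii.invLevel K ((cycLevel i : ℕ+) : ℕ) 0 = 0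
    exact map_zero _)
  map_add' c c' := Subtype.ext (funext fun i => by
    change Prop121vii.invLevel K ((cycLevel i : ℕ+) : ℕ) (_ + _) =
      Prop121vii.invLevel K ((cycLevel i : ℕ+) : ℕ) _ + Prop121vii.invLevel K ((cycLevel i : ℕ+) : ℕ) _
    exact map_add _ _ _)

/-- Components of `limitClassesToZModChain`. [cite: MochizukiAbsTopIII2015, Cor 1.10 (i) p.42] -/
@[simp] theorem limitClassesToZModChain_apply_coe (c : (galCyclotomeTower φ hφ).limitClasses) (i : ℕ) :
    (limitClassesToZModChain K φ hφ c).1 i =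
      Prop121vii.invLevel K ((cycLevel i : ℕ+) : ℕ)
        ((c : ∀ i, continuousCohomology 2 ((galCyclotomeTower φ hφ).obj i)) i) := rfl

/-- `limitClassesToZModChain` is injective (each `inv_n` is). [cite: MochizukiAbsTopIII2015, Cor 1.10 (i) p.42] -/
theorem limitClassesToZModChain_injective : Injective (limitClassesToZModChain K φ hφ) := by
  intro c c' h
  refine Subtype.ext (funext fun i => (invLevel_bijective K ((cycLevel i : ℕ+) : ℕ)).1 ?_)
  exact congrArg (fun x : zmodChain => x.1 i) h

/-- `limitClassesToZModChain` is surjective: the levelwise preimages of a compatible family of residues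
form a compatible family of classes (again by `invLevel_muPowHom_hom` and injectivity of `inv_n`).
[cite: MochizukiAbsTopIII2015, Cor 1.10 (i) p.42] -/
theorem limitClassesToZModChain_surjective : Surjective (limitClassesToZModChain K φ hφ) := by
  intro x
  choose c hc using fun i => (invLevel_bijective K ((cycLevel i : ℕ+) : ℕ)).2 (x.1 i)
  have hmem : (fun i => (c i : continuousCohomology 2 ((galCyclotomeTower φ hφ).obj i))) ∈
      (galCyclotomeTower φ hφ).limitClasses := fun i => by
    change (cohomologyMap (muPowHom K ((cycLevel (i + 1) : ℕ+) : ℕ) ((cycLevel i : ℕ+) : ℕ) (i + 2) _)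
      2).hom (c (i + 1)) = c i
    apply (invLevel_bijective K ((cycLevel i : ℕ+) : ℕ)).1
    refine (invLevel_muPowHom_hom K (N := ((cycLevel (i + 1) : ℕ+) : ℕ)) (n := ((cycLevel i : ℕ+) : ℕ))
      (d := i + 2) (by rw [cycLevel_succ]; rfl) (c (i + 1))).trans ?_
    rw [hc, hc]
    exact x.2 i
  exact ⟨⟨_, hmem⟩, Subtype.ext (funext fun i => hc i)⟩

/-- **`lim_i H²(G_K, μ_{(i+1)!}(K̄)) ≃+ lim_i ℤ/(i+1)!`** (levelwise residue maps).
[cite: MochizukiAbsTopIII2015, Cor 1.10 (i) p.42] -/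
def limitClassesEquivZModChain : (galCyclotomeTower φ hφ).limitClasses ≃+ zmodChain :=
  AddEquiv.ofBijective (limitClassesToZModChain K φ hφ)
    ⟨limitClassesToZModChain_injective K φ hφ, limitClassesToZModChain_surjective K φ hφ⟩

include φ hφ in
/-- **`H²(G_K, μ_Ẑ(G_K)) ≅ Ẑ` for a `p`-adic local field `K`**, given the equivariant identification
`φ : μ_{ℚ/ℤ}(G_K) ≅ μ(K̄)`: continuous `H²` of the limit = limit of the `H²` (NSW (2.7.6), finite `H¹`) =
`lim_i ℤ/(i+1)!` (residue maps) = `Ẑ`. [cite: MochizukiAbsTopIII2015, Cor 1.10 (i) p.42] -/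
theorem nonempty_galCyclotomeH2_addEquiv_zhat :
    Nonempty (galCyclotomeH2 (absoluteGaloisGroup K) ≃+ AbsTopIII.ZHatCoeff.{u}) := by
  obtain ⟨e⟩ := nonempty_zmodChain_addEquiv_zhat.{u}
  exact ⟨(((galCyclotomeTower φ hφ).limitClassesEquiv (finite_H1_galCyclotomeTower K φ hφ)).trans
    (limitClassesEquivZModChain K φ hφ)).trans e⟩

end MLF

/-! ### The discharge -/

/-- **[AbsTopIII] Cor. 1.10 (i)(a) HOLDS** (the named fact `AbsTopIII.Cor_1_10_i_a` of abc-iut-L4-t1's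
`CyclotomicSynchronization.lean`): for every MLF `k` (a finite extension of some `ℚ_p`, as a bare field of
characteristic `0`), the continuous cohomology group `H²(Gal(k̄/k), μ_Ẑ(G_k))` of the group-theoretic
cyclotome is isomorphic to `Ẑ`.  `k` is a non-archimedean local field (`FiniteExtension.*`,
`Padic.isNonarchimedeanLocalField_holds`), local class field theory gives `μ_{ℚ/ℤ}(G_k) ≅ μ(k̄)`
(`mlfGaloisCyclotomeIsRootsOfUnity_holds`), and `nonempty_galCyclotomeH2_addEquiv_zhat` applies.
[cite: MochizukiAbsTopIII2015, Cor 1.10 (i) p.42] -/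
theorem AbsTopIII.Cor_1_10_i_a_holds : AbsTopIII.Cor_1_10_i_a.{u} := by
  intro k _ _ hk
  obtain ⟨p, hp, f, hfin⟩ := hk.exists_padic
  letI : Algebra ℚ_[p] k := f.toAlgebra
  haveI : Module.Finite ℚ_[p] k := hfin
  haveI : IsNonarchimedeanLocalField ℚ_[p] := Padic.isNonarchimedeanLocalField_holds p
  letI := FiniteExtension.normedField ℚ_[p] k
  letI := FiniteExtension.valuativeRel ℚ_[p] k
  haveI : IsNonarchimedeanLocalField k := FiniteExtension.isNonarchimedeanLocalField ℚ_[p] k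
  obtain ⟨φ, hφ⟩ := mlfGaloisCyclotomeIsRootsOfUnity_holds k hk
  exact nonempty_galCyclotomeH2_addEquiv_zhat k φ hφ

end Literature.AnabelianGeometry.AbsoluteAnabelian

end
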